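import Mathlib

/-!
# Stub `stub_ghostDuality` — line `ghost-calculus-chebotarev` of the crux `SubgroupIdentityDesigns`
(stmt-MatrixMultiplication-14079)

Crux
`Summit.MatrixMultiplication.MatrixMultiplication.Theses.LevelGradedCohnUmans.SubgroupIdentityDesigns`;
this file proves the registered stub `stub_ghostDuality` verbatim (name + signature) and lands
`--supports stmt-MatrixMultiplication-14079`.

Content (ghost duality).  `G = GL_m(𝔽_p)`, `ψ = ZMod.stdAddChar`, `F_k` = the functions
`g ↦ Σ_M c_M ψ(tr(M g))` with `c` vanishing on matrices of rank `> k`, `S = H₁H₂H₃` the product set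
of three subgroups.  The identity test (ONE `f ∈ F_k` with `f(1) = 1` and `f(a b g) = 0` whenever
`a b g ≠ 1`) holds IFF every "ghost" `λ : G → ℂ` (supported on `S`, all level-`k` Fourier sums
`Σ_g λ(g) ψ(tr(M g))`, `rk M ≤ k`, vanish) has `λ(1) = 0`.  Pure finite-dimensional linear algebra,
proved abstractly for a finite type `G`, a point `e ∈ S ⊆ G` and a subspace `W ≤ ℂ^G`:

* (→) `apply_eq_zero_of_idTest` + `pairing_eq_zero`: pair `f` against `λ`; `Σ_g λ(g) f(g)` is `0`
  after swapping the two finite sums (rank `≤ k`: ghost hypothesis; rank `> k`: `c_M = 0`), and it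
  is `λ(1)` by the `0/1` pattern of `f` on the support of `λ`.
* (←) `exists_mem_idTest`: with `W = F_k` (the span of the cut-off modes
  `M ↦ [rk M ≤ k] ψ(tr(M ·))`) and `Z` the functions vanishing on `S` (kernel of the restriction to
  `S`), either `δ_1 ∈ W ⊔ Z` — then its `W`-component is the test function — or a linear functional
  `φ` kills `W ⊔ Z` with `φ(δ_1) ≠ 0` (`Submodule.exists_dual_map_eq_bot_of_notMem`), and
  `λ(g) := φ(δ_g)` is a ghost through `1` (`φ(h) = Σ_g φ(δ_g) h(g)`, delta basis of `ℂ^G`).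
-/

set_option linter.dupNamespace false

noncomputable section

open scoped BigOperators Classical

namespace Summit.MatrixMultiplication.MatrixMultiplication.Theorems.GhostCalculusChebotarev

namespace GhostDuality

/-! ## Abstract duality on `ℂ^G` for a finite type `G` -/

/-- A linear functional on `ℂ^G` is the pairing against its values on the delta basis:
`φ(h) = Σ_g φ(δ_g) h(g)`. -/
theorem dual_apply_eq_sum {G : Type*} [Fintype G] [DecidableEq G]
    (φ : Module.Dual ℂ (G → ℂ)) (h : G → ℂ) :
    φ h = ∑ g, φ (Pi.single g 1) * h g := by
  calc φ h = φ (∑ g, Pi.single g (h g)) := by rw [Finset.univ_sum_single]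
    _ = ∑ g, φ (Pi.single g (h g)) := map_sum φ _ _
    _ = ∑ g, φ (Pi.single g 1) * h g := Finset.sum_congr rfl fun g _ => by
        rw [show (Pi.single g (h g) : G → ℂ) = h g • (Pi.single g 1 : G → ℂ) by
          rw [← Pi.single_smul', smul_eq_mul, mul_one], map_smul, smul_eq_mul, mul_comm]

/-- **Separation (the `←` half, abstractly).**  Let `W ≤ ℂ^G`, `S ⊆ G`, `e ∈ S`.  If every `λ`
supported on `S` and annihilating `W` (`Σ_g λ(g) w(g) = 0` for `w ∈ W`) has `λ(e) = 0`, then some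
`w ∈ W` has `w(e) = 1` and `w = 0` on `S ∖ {e}`.  (Either `δ_e ∈ W ⊔ Z`, `Z` the functions vanishing
on `S` — the kernel of the restriction `ℂ^G → ℂ^S` — and the `W`-component of `δ_e` works; or a
functional `φ` separating `δ_e` from `W ⊔ Z` yields the forbidden `λ(g) := φ(δ_g)`.) -/
theorem exists_mem_idTest {G : Type*} [Fintype G] {S : Set G} {e : G} (he : e ∈ S)
    (W : Submodule ℂ (G → ℂ))
    (hghost : ∀ lam : G → ℂ, (∀ g, lam g ≠ 0 → g ∈ S) →
      (∀ w ∈ W, ∑ g, lam g * w g = 0) → lam e = 0) :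
    ∃ w ∈ W, w e = 1 ∧ ∀ g ∈ S, g ≠ e → w g = 0 := by
  have hZ : ∀ z ∈ LinearMap.ker (LinearMap.funLeft ℂ ℂ ((↑) : S → G)), ∀ g ∈ S, z g = 0 :=
    fun z hz g hg => congrFun (LinearMap.mem_ker.mp hz) ⟨g, hg⟩
  have hδ : (Pi.single e 1 : G → ℂ) ∈ W ⊔ LinearMap.ker (LinearMap.funLeft ℂ ℂ ((↑) : S → G)) := by
    by_contra hδ
    obtain ⟨φ, hφδ, hφ⟩ := Submodule.exists_dual_map_eq_bot_of_notMem hδ inferInstance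
    have hφ0 : ∀ h ∈ W ⊔ LinearMap.ker (LinearMap.funLeft ℂ ℂ ((↑) : S → G)), φ h = 0 :=
      fun h hh => by
        rw [← Submodule.mem_bot ℂ, ← hφ]
        exact Submodule.mem_map_of_mem hh
    refine hφδ (hghost (fun g => φ (Pi.single g 1)) (fun g hg => ?_) (fun w hw => ?_))
    · by_contra hgS
      refine hg (hφ0 _ (Submodule.mem_sup_right (LinearMap.mem_ker.mpr (funext fun s => ?_))))
      exact Pi.single_eq_of_ne (fun hsg : (s : G) = g => hgS (hsg ▸ s.2)) _
    · rw [← dual_apply_eq_sum φ w]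
      exact hφ0 w (Submodule.mem_sup_left hw)
  obtain ⟨w, hw, z, hz, hwz⟩ := Submodule.mem_sup.mp hδ
  refine ⟨w, hw, ?_, fun g hg hge => ?_⟩
  · have h := congrFun hwz e
    rw [Pi.add_apply, hZ z hz e he, add_zero, Pi.single_eq_same] at h
    exact h
  · have h := congrFun hwz g
    rw [Pi.add_apply, hZ z hz g hg, add_zero, Pi.single_eq_of_ne hge] at h
    exact h

/-- **Pairing (the `→` half, abstractly).**  If `f(e) = 1`, `f = 0` on `S ∖ {e}`, `λ` is supported
on `S` and `Σ_g λ(g) f(g) = 0`, then `λ(e) = 0` (the pairing collapses to `λ(e) f(e)`). -/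
theorem apply_eq_zero_of_idTest {G : Type*} [Fintype G] {S : Set G} {e : G} {f lam : G → ℂ}
    (h1 : f e = 1) (h0 : ∀ g ∈ S, g ≠ e → f g = 0) (hsupp : ∀ g, lam g ≠ 0 → g ∈ S)
    (hpair : ∑ g, lam g * f g = 0) : lam e = 0 := by
  rw [← mul_one (lam e), ← h1, ← hpair, eq_comm]
  refine Finset.sum_eq_single e (fun g _ hge => ?_) (fun h => absurd (Finset.mem_univ e) h)
  by_cases hg : lam g = 0
  · rw [hg, zero_mul]
  · rw [h0 g (hsupp g hg) hge, mul_zero]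

/-- **Swapping the sums.**  `Σ_g λ(g) Σ_i c_i v_i(g) = Σ_i c_i Σ_g λ(g) v_i(g) = 0` as soon as, for
each mode `i`, either its coefficient `c_i` or its pairing `Σ_g λ(g) v_i(g)` vanishes. -/
theorem pairing_eq_zero {G ι : Type*} [Fintype G] [Fintype ι] (lam : G → ℂ) (c : ι → ℂ)
    (v : ι → G → ℂ) (h : ∀ i, c i = 0 ∨ ∑ g, lam g * v i g = 0) :
    ∑ g, lam g * ∑ i, c i * v i g = 0 := by
  simp_rw [Finset.mul_sum]
  rw [Finset.sum_comm]
  refine Finset.sum_eq_zero fun i _ => ?_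
  calc ∑ g, lam g * (c i * v i g) = c i * ∑ g, lam g * v i g := by
        rw [Finset.mul_sum]
        exact Finset.sum_congr rfl fun g _ => by ring
    _ = 0 := by
        rcases h i with h | h
        · rw [h, zero_mul]
        · rw [h, mul_zero]

end GhostDuality

variable {p m : ℕ} [Fact p.Prime]

open GhostDuality in
/-- **Ghost duality** (registered stub `stub_ghostDuality` of line `ghost-calculus-chebotarev`).
For any subgroup triple `H₁, H₂, H₃ ≤ GL_m(𝔽_p)` and level `k`: the identity-test clause of the crux
(one rank-`≤ k` Fourier function `f` with `f(1) = 1` and `f(a b g) = 0` whenever `a b g ≠ 1`) holds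
IFF every `λ : GL_m(𝔽_p) → ℂ` supported on the product set `H₁H₂H₃` all of whose level-`k` Fourier
sums `Σ_g λ(g) ψ(tr(M g))` (`rk M ≤ k`) vanish has `λ(1) = 0`.  (→) is the pairing
`apply_eq_zero_of_idTest` after swapping two finite sums (`pairing_eq_zero`); (←) is the
finite-dimensional separation `exists_mem_idTest` for `W` the span of the cut-off modes
`M ↦ [rk M ≤ k] ψ(tr(M ·))`, whose coefficients (`Submodule.mem_span_range_iff_exists_fun`), cut off
above rank `k`, form the coefficient table. -/
theorem stub_ghostDuality (k : ℕ)
    (H₁ H₂ H₃ : Subgroup (Matrix.GeneralLinearGroup (Fin m) (ZMod p))) :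
    (∃ c : Matrix (Fin m) (Fin m) (ZMod p) → ℂ, (∀ M, k < M.rank → c M = 0) ∧
        (∑ M : Matrix (Fin m) (Fin m) (ZMod p), c M * ZMod.stdAddChar (Matrix.trace (M *
          ((1 : Matrix.GeneralLinearGroup (Fin m) (ZMod p)) : Matrix (Fin m) (Fin m) (ZMod p))))) = 1 ∧
        ∀ a ∈ H₁, ∀ b ∈ H₂, ∀ g ∈ H₃, a * b * g ≠ 1 →
          (∑ M : Matrix (Fin m) (Fin m) (ZMod p), c M * ZMod.stdAddChar (Matrix.trace (M *
            ((a * b * g : Matrix.GeneralLinearGroup (Fin m) (ZMod p)) :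
              Matrix (Fin m) (Fin m) (ZMod p))))) = 0) ↔
      ∀ lam : Matrix.GeneralLinearGroup (Fin m) (ZMod p) → ℂ,
        (∀ g, lam g ≠ 0 → ∃ a ∈ H₁, ∃ b ∈ H₂, ∃ c ∈ H₃, g = a * b * c) →
        (∀ M : Matrix (Fin m) (Fin m) (ZMod p), M.rank ≤ k →
          ∑ g : Matrix.GeneralLinearGroup (Fin m) (ZMod p),
            lam g * ZMod.stdAddChar (Matrix.trace (M * (g : Matrix (Fin m) (Fin m) (ZMod p)))) = 0) →
        lam 1 = 0 := by
  -- `1 ∈ S = H₁H₂H₃`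
  have h1S : (1 : Matrix.GeneralLinearGroup (Fin m) (ZMod p)) ∈
      {g : Matrix.GeneralLinearGroup (Fin m) (ZMod p) |
        ∃ a ∈ H₁, ∃ b ∈ H₂, ∃ c ∈ H₃, g = a * b * c} :=
    ⟨1, H₁.one_mem, 1, H₂.one_mem, 1, H₃.one_mem, by rw [mul_one, mul_one]⟩
  constructor
  · rintro ⟨c, hc, h1, h0⟩ lam hsupp hann
    refine apply_eq_zero_of_idTest
      (S := {g : Matrix.GeneralLinearGroup (Fin m) (ZMod p) |
        ∃ a ∈ H₁, ∃ b ∈ H₂, ∃ c ∈ H₃, g = a * b * c})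
      (f := fun g => ∑ M : Matrix (Fin m) (Fin m) (ZMod p),
        c M * ZMod.stdAddChar (Matrix.trace (M * (g : Matrix (Fin m) (Fin m) (ZMod p)))))
      h1 (fun g hg hne => ?_) hsupp
      (pairing_eq_zero lam c _ fun M => (le_or_gt M.rank k).symm.imp (hc M) (hann M))
    obtain ⟨a, ha, b, hb, c', hc', rfl⟩ := hg
    exact h0 a ha b hb c' hc' hne
  · intro hghost
    -- `W` = the span of the cut-off modes `M ↦ [rk M ≤ k] ψ(tr(M ·))`
    obtain ⟨w, hw, hw1, hw0⟩ := exists_mem_idTest h1S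
      (Submodule.span ℂ (Set.range fun M : Matrix (Fin m) (Fin m) (ZMod p) =>
        if M.rank ≤ k then (fun g : Matrix.GeneralLinearGroup (Fin m) (ZMod p) =>
          ZMod.stdAddChar (Matrix.trace (M * (g : Matrix (Fin m) (Fin m) (ZMod p))))) else 0))
      (fun lam hsupp hW => hghost lam hsupp fun M hM => by
        have h := hW _ (Submodule.subset_span ⟨M, rfl⟩)
        simp only [if_pos hM] at h
        exact h)
    obtain ⟨c, hcw⟩ := (Submodule.mem_span_range_iff_exists_fun ℂ).mp hw
    -- the coefficient table: `c` cut off above rank `k`; its synthesis is `w`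
    have hsum : ∀ g : Matrix.GeneralLinearGroup (Fin m) (ZMod p),
        (∑ M : Matrix (Fin m) (Fin m) (ZMod p), (if M.rank ≤ k then c M else 0) *
          ZMod.stdAddChar (Matrix.trace (M * (g : Matrix (Fin m) (Fin m) (ZMod p))))) = w g := by
      intro g
      rw [← hcw, Finset.sum_apply]
      refine Finset.sum_congr rfl fun M _ => ?_
      rw [Pi.smul_apply, smul_eq_mul]
      split_ifs
      · rfl
      · rw [zero_mul, Pi.zero_apply, mul_zero]
    refine ⟨fun M => if M.rank ≤ k then c M else 0, fun M hM => if_neg (not_le.mpr hM), ?_,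
      fun a ha b hb g hg hne => ?_⟩
    · rw [hsum]
      exact hw1
    · rw [hsum]
      exact hw0 _ ⟨a, ha, b, hb, g, hg, rfl⟩ hne

end Summit.MatrixMultiplication.MatrixMultiplication.Theorems.GhostCalculusChebotarev

end
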